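import Summits.ABC.IUTFork.Cor312TwoPlaceSetting
import Summits.ABC.IUTFork.Cor312NaiveProvPinnedOperators
import HarnessLib

/-!
# [IUTchIII] Cor. 3.12 — the TWO-PLACE bed, part III (REPAIR branch engine request E4): the place-dependent LOG-SHELL region
# operator and the THREE PINS on the two-place setting

Record file (D-0012; abc-iut cell, REPAIR branch rung LADDER-ABC:A2.RP, seat abc-iut-rp-m4; «GO rp-m4 E4», abc-iut-rp-plan
2026-08-26T08:18:35Z (6), «pins part II optional»). TAKES NO SIDE on [IUTchIII] Cor. 3.12 or on any author; MODEL DATA + proofs, no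
`Prop` fact, nothing asserted. Parts I/II (`Cor312TwoPlaceThm311` p433610, `Cor312TwoPlaceSetting` p433752) built the two-place model and
setting `twoSetting p c d` (Θ-image `B_{j²−d(v)}`, honest q-image `B_1`) and proved its cells WITHOUT a region reading. THIS FILE supplies
abc-iut-w5-d230's pins (`Cor312PinnedRegions`, p417551; three pins p418935) on it, with ONE region operator for both pilots:
* §1 (any index skeleton `T`) the dilation `dilate p k` of a packet by `p^{−k}` (abc-iut-w4-d103's `Cor312PinnedLogShell.dilate`, made
  index-generic: `dilate_pBall : B_e ↦ B_{e−k}`, commutes with every packet automorphism) and the predicate `IsThetaType` («every bad-place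
  coordinate is `±q^{j²}`»: true of the Θ-pilot's splitting monoids, false of the q-pilot's Kummer datum, invariant under ⟨(Ind1) ∪ (Ind2)⟩
  — w4-d103's `thetaTypeData` of `Cor312PinnedLogShellOneRho`, index-generic);
* §2 the operator `rho2 p d X := 𝓘_{d(v)}·(Ψ ↦ Ψ_j·𝒪)(X)` on Θ-type data, `(Ψ ↦ Ψ_j·𝒪)(X)` otherwise — abc-iut-w4-d026's index-generic
  `NaiveProv.orbitRegion` (p428781) followed, on Θ-type data only, by the place's log-shell dilation (the «ρ/(Ind3) locus» of the census,
  one place at a time); (hρ) equivariance under the whole group (`rho2_equivariant`), values `rho2_Psi = B_{j²−d(v)}`, `rho2_qDatum = B_1`;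
* §3 on `twoIndex`: **`two_pinnedRegions3` — (hρ) ∧ (pΘ) ∧ (pq′) ∧ (pL) HOLD** at `twoSetting p c d` for `rho2 p d` and w4-d026's honest
  q-datum `NaiveProv.qDatum` (the Kummer datum of the setting's own q-pilot datum `gen`); hence the pinned cells at `depth = (0, 3)`:
  `two_pinned_not_S` (the residual S FAILS for THIS reading — an instance of part II's `two_not_S`), `two_pinned_not_gapA3`,
  `two_pinned_not_gapH3`, and the protocol-grade witness `two_place_pinned_witness`: typed Thm. 3.11 ∧ BridgeHyps ∧ `|log(q)| > 0` ∧
  PinnedRegions3 ∧ Statement ∧ ¬(local portion at the place `0`) ∧ ¬Licence ∧ ¬GapA3 ∧ ¬GapH3 ∧ ¬S.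
HONEST SCOPE: interface/toy level; the dilation sits in the region operator exactly as in the one-place log-shell family of record
(`rhoOne`); no judgement on print; standard axioms. [claim: Mochizuki2012, status: disputed] [cite: ScholzeStix2018, §2.2 pp. 9–10]
-/

noncomputable section

open Set

namespace Summit.ABC.IUTFork.Cor312Vol.TwoPlace

open Thm311 Cor312 Cor312Vol NaiveProv PinnedWitness Literature.IUT.LogThetaLattice

/-! ## 1. Dilation and Θ-type data over any index skeleton -/

section Generic

variable {T : ThetaIndex} (p : ℕ) (k : ℕ)

/-- **Dilation of a packet by `p^{−k}`** (the log-shell inflation `𝓘_k = p^{−k}𝒪` applied to a region; abc-iut-w4-d103's `dilate`,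
index-generic). MODEL DATA. [claim: Mochizuki2012, status: disputed] -/
def dilate (j : T.Label) (vQ : T.VQ) (A : Set ((signShells T).Packet j vQ)) : Set ((signShells T).Packet j vQ) :=
  (fun x => ((p : ℚ) ^ (-(k : ℤ))) • x) '' A

/-- Dilation commutes with every packet automorphism (linearity). [folklore] -/
theorem image_dilate (Φ : (signShells T).PacketAut) (j : T.Label) (vQ : T.VQ) (A : Set ((signShells T).Packet j vQ)) :
    Φ j vQ '' dilate p k j vQ A = dilate p k j vQ (Φ j vQ '' A) := by
  unfold dilate
  rw [Set.image_image, Set.image_image]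
  exact Set.image_congr fun x _ => by rw [map_smul]

/-- Dilation of the empty region is empty. [folklore] -/
theorem dilate_empty (j : T.Label) (vQ : T.VQ) : dilate p k j vQ (∅ : Set ((signShells T).Packet j vQ)) = ∅ := Set.image_empty _

variable [hp : Fact p.Prime]

/-- `p^{−k}·x ∈ B_{e−k} ⟺ x ∈ B_e`. [folklore] -/
theorem smul_mem_pBall_iff (j : T.Label) (vQ : T.VQ) (e : ℤ) (x : (signShells T).Packet j vQ) :
    ((p : ℚ) ^ (-(k : ℤ))) • x ∈ pBall p j vQ (e - k) ↔ x ∈ pBall p j vQ e := by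
  show (coord j vQ (((p : ℚ) ^ (-(k : ℤ))) • x) = 0 ∨ _ ≤ padicValRat p (coord j vQ (((p : ℚ) ^ (-(k : ℤ))) • x))) ↔
    (coord j vQ x = 0 ∨ _ ≤ padicValRat p (coord j vQ x))
  rw [map_smul, smul_eq_mul]
  have hd : ((p : ℚ) ^ (-(k : ℤ))) ≠ 0 := NaiveWitness.ppow_ne_zero p _
  by_cases hx : coord j vQ x = 0
  · simp [hx]
  · have hne : (p : ℚ) ^ (-(k : ℤ)) * coord j vQ x ≠ 0 := mul_ne_zero hd hx
    rw [padicValRat.mul hd hx, NaiveWitness.padicValRat_ppow]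
    constructor
    · rintro (h | h)
      · exact absurd h hne
      · exact Or.inr (by linarith)
    · rintro (h | h)
      · exact absurd h hx
      · exact Or.inr (by linarith)

/-- **`𝓘_k · B_e = B_{e−k}`.** [folklore] -/
theorem dilate_pBall (j : T.Label) (vQ : T.VQ) (e : ℤ) : dilate p k j vQ (pBall p j vQ e) = pBall p j vQ (e - k) := by
  have hd : ((p : ℚ) ^ (-(k : ℤ))) ≠ 0 := NaiveWitness.ppow_ne_zero p _
  ext y
  constructor
  · rintro ⟨x, hx, rfl⟩
    exact (smul_mem_pBall_iff p k j vQ e x).2 hx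
  · intro hy
    refine ⟨((p : ℚ) ^ (-(k : ℤ)))⁻¹ • y, (smul_mem_pBall_iff p k j vQ e _).1 ?_, ?_⟩
    · rwa [smul_inv_smul₀ hd]
    · exact smul_inv_smul₀ hd y

omit hp in
/-- **Θ-TYPE data**: every bad-place coordinate at every label `j ∈ 𝔽_l^⋇` is `±q^{j²}` (the sign-translates of the Θ-pilot's
splitting-monoid elements are such; the q-pilot's Kummer datum, with coordinates `±q`, is not — w4-d103's `thetaTypeData`,
index-generic). Bookkeeping predicate on data. [claim: Mochizuki2012, status: disputed] -/
def IsThetaType (X : ∀ v : T.V, v ∈ T.Vbad → Set ((signShells T).StarPacket v)) : Prop :=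
  ∀ (v : T.V) (hv : v ∈ T.Vbad), ∀ ψ ∈ X v hv, ∀ j : T.LabelStar,
    bcoord v j ψ = (p : ℚ) ^ ((j.1 : ℕ) ^ 2) ∨ bcoord v j ψ = -(p : ℚ) ^ ((j.1 : ℕ) ^ 2)

omit hp in
/-- The Θ-pilot's splitting monoids `Ψ_v = {(±q^{j²})_j}` (w4-d026's `PsiOf (thetaVec1 p)`) are Θ-type. [folklore] -/
theorem isThetaType_Psi : IsThetaType p (fun (v : T.V) (_ : v ∈ T.Vbad) => PsiOf (thetaVec1 p) v) :=
  fun _ _ _ hψ j => bcoord_of_mem_PsiOf_thetaVec1 p hψ j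

omit hp in
/-- The EMPTY datum is (vacuously) Θ-type. [folklore] -/
theorem isThetaType_empty : IsThetaType p (fun (v : T.V) (_ : v ∈ T.Vbad) => (∅ : Set ((signShells T).StarPacket v))) :=
  fun _ _ _ h => absurd h (Set.notMem_empty _)

omit hp in
/-- A sign `ε` (`|ε| = 1`) preserves the set `{q^{j²}, −q^{j²}}`. [folklore] -/
theorem sign_mul_mem {ε t a : ℚ} (hε : |ε| = 1) (ht : t = a ∨ t = -a) : ε * t = a ∨ ε * t = -a := by
  rcases (abs_eq (zero_le_one' ℚ)).1 hε with rfl | rfl <;> rcases ht with rfl | rfl <;> simp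

omit hp in
/-- **Θ-type is invariant under ⟨(Ind1) ∪ (Ind2)⟩** (every such family multiplies bad-place coordinates by signs, w4-d026's
`bcoord_starAut`). [folklore] -/
theorem isThetaType_transport_iff {Φ : (signShells T).PacketAut}
    (hΦ : Φ ∈ Subgroup.closure ((signShells T).Ind1Family ∪ (signShells T).Ind2Family))
    (X : ∀ v : T.V, v ∈ T.Vbad → Set ((signShells T).StarPacket v)) :
    IsThetaType p (fun v hv => (signShells T).starAut Φ v '' X v hv) ↔ IsThetaType p X := by
  have hs := actsBySignsAll_of_mem_closure hΦ
  constructor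
  · intro h v hv ψ hψ j
    obtain ⟨ε, hε, hΦε⟩ := bcoord_starAut hs v j
    have h1 := h v hv _ ⟨ψ, hψ, rfl⟩ j
    rw [hΦε ψ] at h1
    have hεε : ε * ε = 1 := mul_self_of_abs_eq_one hε
    have h2 := sign_mul_mem (a := (p : ℚ) ^ ((j.1 : ℕ) ^ 2)) hε h1
    rwa [← mul_assoc, hεε, one_mul] at h2
  · rintro h v hv _ ⟨ψ, hψ, rfl⟩ j
    obtain ⟨ε, hε, hΦε⟩ := bcoord_starAut hs v j
    rw [hΦε ψ]
    exact sign_mul_mem hε (h v hv ψ hψ j)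

/-- A label of `𝔽_l^⋇` with value `2` (`l⋆ ≥ 2`). [folklore] -/
def labTwo : T.LabelStar := ⟨⟨2, by have := T.two_le_lstar; omega⟩, fun h => by have := congrArg Fin.val h; simp at this⟩

omit hp in
/-- Its value. [folklore] -/
theorem labTwo_val : ((labTwo (T := T)).1 : ℕ) = 2 := rfl

variable (v₁ : T.V) (hv₁ : v₁ ∈ T.Vbad) (c : ℝ)

/-- **The q-pilot's Kummer datum (w4-d026's `NaiveProv.qDatum`, coordinates `±q`) is NOT Θ-type** (at the label `2`: `q ≠ ±q⁴`).
[folklore] -/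
theorem not_isThetaType_qDatum : ¬ IsThetaType p (qDatum p v₁ hv₁ c) := by
  intro h
  have h1 := h v₁ hv₁ _ (qTuple_mem_qDatum p v₁ hv₁ c v₁ hv₁) labTwo
  have hq : bcoord v₁ labTwo (fun j : T.LabelStar => qVec p 1 v₁ j.1) = (p : ℚ) ^ (1 : ℕ) := coordAt_qVec p 1 v₁ _
  rw [hq, labTwo_val] at h1
  have hp0 : (0 : ℚ) < (p : ℚ) := by exact_mod_cast hp.out.pos
  have hpos : (0 : ℚ) < (p : ℚ) ^ (2 ^ 2) := pow_pos hp0 _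
  rcases h1 with h1 | h1
  · have h1' : (p ^ 1 : ℕ) = p ^ (2 ^ 2) := by exact_mod_cast h1
    have h4 := Nat.pow_right_injective hp.out.two_le h1'
    norm_num at h4
  · have : (0 : ℚ) < (p : ℚ) ^ (1 : ℕ) := pow_pos hp0 _
    linarith

/-! ## 2. The place-dependent log-shell operator -/

variable (d : T.VQ → ℕ)

open scoped Classical in
/-- **THE TWO-PILOT REGION OPERATOR with place-dependent log-shell inflation**: on Θ-type data, w4-d026's `Ψ ↦ Ψ_j·𝒪` followed by the
dilation `𝓘_{d(v)}` of the place; on all other data, `Ψ ↦ Ψ_j·𝒪` itself (abc-iut-w4-d103's one-ρ `rhoOne` with the exponent read off the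
place). MODEL DATA. [claim: Mochizuki2012, status: disputed] -/
def rho2 (X : ∀ v : T.V, v ∈ T.Vbad → Set ((signShells T).StarPacket v)) (j : T.Label) (vQ : T.VQ) :
    Set ((signShells T).Packet j vQ) :=
  if IsThetaType p X then dilate p (d vQ) j vQ (orbitRegion p X j vQ) else orbitRegion p X j vQ

omit hp in
/-- **(hρ) for `rho2`: equivariance under the whole group ⟨(Ind1) ∪ (Ind2)⟩** (Θ-type is invariant; `orbitRegion` is equivariant,
w4-d026; dilation commutes with the family). [folklore] -/
theorem rho2_equivariant {Φ : (signShells T).PacketAut}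
    (hΦ : Φ ∈ Subgroup.closure ((signShells T).Ind1Family ∪ (signShells T).Ind2Family))
    (X : ∀ v : T.V, v ∈ T.Vbad → Set ((signShells T).StarPacket v)) (j : T.Label) (vQ : T.VQ) :
    rho2 p d (fun v hv => (signShells T).starAut Φ v '' X v hv) j vQ = Φ j vQ '' rho2 p d X j vQ := by
  classical
  unfold rho2
  by_cases hX : IsThetaType p X
  · rw [if_pos ((isThetaType_transport_iff p hΦ X).2 hX), if_pos hX, NaiveProv.orbitRegion_equivariant p hΦ, image_dilate]
  · rw [if_neg (fun h => hX ((isThetaType_transport_iff p hΦ X).1 h)), if_neg hX, NaiveProv.orbitRegion_equivariant p hΦ]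

/-- **`rho2` on the Θ-pilot's splitting monoids: the INFLATED cylinder `B_{j²−d(v)}`** under a bad place (`𝓘_{d(v)}·𝒪 = B_{−d(v)}`
elsewhere and at the zero label). [folklore] -/
theorem rho2_Psi (j : T.Label) (vQ : T.VQ) :
    rho2 p d (fun (v : T.V) (_ : v ∈ T.Vbad) => PsiOf (thetaVec1 p) v) j vQ = pBall p j vQ (tE j vQ - d vQ) := by
  classical
  unfold rho2
  rw [if_pos (isThetaType_Psi p), NaiveProv.orbitRegion_Psi, dilate_pBall]

/-- **`rho2` on the q-pilot's Kummer datum: the HONEST `B_1`** at the labels of `𝔽_l^⋇` under a bad place (`𝒪` elsewhere) — no inflation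
on the q-side. [folklore] -/
theorem rho2_qDatum (j : T.Label) (vQ : T.VQ) : rho2 p d (qDatum p v₁ hv₁ c) j vQ = pBall p j vQ (qE j vQ) := by
  classical
  unfold rho2
  rw [if_neg (not_isThetaType_qDatum p v₁ hv₁ c), NaiveProv.orbitRegion_qDatum]

omit hp in
/-- `rho2` sends the empty datum to the empty region at a nonzero label under a bad place (the operator is not constant). [folklore] -/
theorem rho2_empty {j : T.Label} (hj : j ≠ 0) {vQ : T.VQ} (hvQ : HasBad vQ) :
    rho2 p d (fun (v : T.V) (_ : v ∈ T.Vbad) => (∅ : Set ((signShells T).StarPacket v))) j vQ = ∅ := by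
  classical
  unfold rho2
  rw [if_pos (isThetaType_empty p), NaiveProv.orbitRegion_empty p hj hvQ, dilate_empty]

end Generic

/-! ## 3. The three pins on the two-place setting -/

section Two

variable (p : ℕ) [hp : Fact p.Prime] (c : ℝ) (d : twoIndex.VQ → ℕ)

omit hp in
/-- Every rational place of the two-place index lies under a bad place. [folklore] -/
theorem two_hasBad (vQ : twoIndex.VQ) : HasBad vQ := ⟨vQ, trivial, rfl⟩

omit hp in
/-- The column-`m` Kummer image of the Frobenius-like splitting monoids of the two-place model IS `Ψ` again (the twist is a sign).
[folklore] -/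
theorem two_frobΨ (n m : ℤ) :
    ((twoFull p c).col n).frobΨ m = fun (v : twoIndex.V) (_ : v ∈ twoIndex.Vbad) => PsiOf (thetaVec1 p) v := by
  funext v hv
  exact image_PsiOf_twist (thetaVec1 p) m v

/-- **(hρ) ∧ (pΘ) — the Θ-pilot pin HOLDS** at the two-place setting for `rho2 p d`: equivariance, and at every `(m, j, v)` the Kummer
image `B_{j²−d(v)}` of the Θ-pilot IS the operator's value on the column-`m` Kummer image of the splitting monoids. [claim: Mochizuki2012, status: disputed] -/
theorem two_thetaPinned : ThetaPinned (twoFull p c).toLatticeSituation (twoSetting p c d) (rho2 p d) := by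
  refine ⟨fun Φ hΦ Ψ j vQ => rho2_equivariant p d hΦ Ψ j vQ, fun m j vQ => ?_⟩
  rw [two_frobΨ, rho2_Psi, tE_of_hasBad (two_hasBad vQ), two_thetaRegion]

/-- **(pq′) — the q-pilot pin HOLDS** for the SAME operator and w4-d026's honest Kummer datum of the setting's q-pilot datum (`q_v = gen`
at both places; read at the place `0`): both sides are `B_1` on `𝔽_l^⋇`, `𝒪` at the zero label. [claim: Mochizuki2012, status: disputed] -/
theorem two_qPinned :
    QPinned (twoFull p c).toLatticeSituation (twoSetting p c d) (rho2 p d) (qDatum p (0 : twoIndex.V) trivial c) := fun j vQ => by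
  rw [rho2_qDatum]
  by_cases hj : j = 0
  · subst hj
    rw [qE_zero]
    rfl
  · rw [qE_of_hasBad (two_hasBad vQ) hj, two_qRegion p c d hj]

omit hp in
/-- **(pL) — the link pin HOLDS** contentfully (exponent objects, identity `q^ℕ ≅ q^ℕ` generator-to-generator). [claim: Mochizuki2012, status: disputed] -/
theorem two_linkPinned : LinkPinned (twoFull p c).toLatticeSituation (twoSetting p c d) :=
  ⟨Equiv.refl ℤ, by rw [two_thetaPilot]; rfl⟩

/-- **`PinnedRegions3` HOLDS at the two-place setting** (for every inflation profile `d`). [claim: Mochizuki2012, status: disputed] -/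
theorem two_pinnedRegions3 :
    PinnedRegions3 (twoFull p c).toLatticeSituation (twoSetting p c d) (rho2 p d) (qDatum p (0 : twoIndex.V) trivial c) :=
  ⟨⟨two_thetaPinned p c d, two_qPinned p c d⟩, two_linkPinned p c d⟩

/-- At `depth = (0, 3)`: **the residual S FAILS for the pinned reading** (instance of part II's `two_not_S`). [folklore] -/
theorem two_pinned_not_S :
    ¬ PilotKummerIndRelated (twoFull p c).toLatticeSituation (twoSetting p c depth) (rho2 p depth)
      (qDatum p (0 : twoIndex.V) trivial c) :=
  two_not_S p c _ _ (two_pinnedRegions3 p c depth).1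

/-- … the identification-level gap `GapA3` FAILS (pins hold, R3 fails). [folklore] -/
theorem two_pinned_not_gapA3 :
    ¬ GapA3 (twoFull p c).toLatticeSituation (twoSetting p c depth) (rho2 p depth) (qDatum p (0 : twoIndex.V) trivial c) := fun h =>
  two_not_reading3 p c fun i vQ => h (two_pinnedRegions3 p c depth) (Setting.labelSucc i) vQ

/-- … and the hull-level gap `GapH3` FAILS (pins hold, Licence fails). [folklore] -/
theorem two_pinned_not_gapH3 :
    ¬ GapH3 (twoFull p c).toLatticeSituation (twoSetting p c depth) (rho2 p depth) (qDatum p (0 : twoIndex.V) trivial c) :=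
  two_not_gapH3 p c _ _ (two_pinnedRegions3 p c depth)

/-- **THE PINNED TWO-PLACE WITNESS (protocol grade), at `c = log p`**: typed Thm. 3.11 ∧ `BridgeHyps` ∧ `|log(q)| > 0` ∧ `PinnedRegions3`,
the typed Statement HOLDS, the local portion at the place `0` FAILS, and the Licence, `GapA3`, `GapH3` and the residual S all FAIL — a
pin-respecting model of the typed Corollary with NO packetwise supplier. The operator is honest (not constant: `rho2_empty` vs `rho2_Psi`).
No judgement on print. [folklore] -/
theorem two_place_pinned_witness :
    (twoFull p (Real.log p)).Statement ∧ BridgeHyps (twoSetting p (Real.log p) depth) ∧ (twoSetting p (Real.log p) depth).AbsLogQPos ∧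
      PinnedRegions3 (twoFull p (Real.log p)).toLatticeSituation (twoSetting p (Real.log p) depth) (rho2 p depth)
        (qDatum p (0 : twoIndex.V) trivial (Real.log p)) ∧
      Summit.ABC.IUTFork.Cor312.Setting.Statement (twoSetting p (Real.log p) depth) ∧
      ¬ (processionNormalized (fun i : Fin twoIndex.lstar => (twoSetting p (Real.log p) depth).qLocal (Setting.labelSucc i) 0) ≤
          processionNormalized (fun i : Fin twoIndex.lstar =>
            ((twoSetting p (Real.log p) depth).thetaLocal (Setting.labelSucc i) 0).untopD 0)) ∧
      ¬ Thm311ToCor312.Licence (twoSetting p (Real.log p) depth) ∧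
      ¬ GapA3 (twoFull p (Real.log p)).toLatticeSituation (twoSetting p (Real.log p) depth) (rho2 p depth)
        (qDatum p (0 : twoIndex.V) trivial (Real.log p)) ∧
      ¬ GapH3 (twoFull p (Real.log p)).toLatticeSituation (twoSetting p (Real.log p) depth) (rho2 p depth)
        (qDatum p (0 : twoIndex.V) trivial (Real.log p)) ∧
      ¬ PilotKummerIndRelated (twoFull p (Real.log p)).toLatticeSituation (twoSetting p (Real.log p) depth) (rho2 p depth)
        (qDatum p (0 : twoIndex.V) trivial (Real.log p)) :=
  have hc : 0 < Real.log p := Real.log_pos (by exact_mod_cast hp.out.one_lt)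
  ⟨twoFull_statement p _, two_bridgeHyps p _ depth hc.le, two_absLogQPos p _ depth hc, two_pinnedRegions3 p _ depth,
    two_statement p _ hc, two_local_fails_at_zero p _ hc, two_not_licence p _, two_pinned_not_gapA3 p _, two_pinned_not_gapH3 p _,
    two_pinned_not_S p _⟩

end Two

end Summit.ABC.IUTFork.Cor312Vol.TwoPlace

end
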